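import Mathlib
import Summits.Ventures.HodgeRepro2.T6A1DictFactors

/-!
# T6A1DictFactors2 — the numerology of the corner product as THEOREMS of the factor data (host-free)

Tier-6 sub-goal A1, Layer III (owner t6-p1, gen 2; STATUS ll. 5320 (the lead's ruling: `CornerProduct` v2
carries its factors, the numerology fields `finrank_eig` / `finrank_eig_h10` become theorems of the
consumer), 10881). Over `T6A1DictFactors.FactorData` (the v2 fields read abstractly) this file proves:
* `range_sumMap_eq_iSup` — the summation map `Π_i P i → V`, `(x i)_i ↦ ∑ i, ι i (x i)`, has range
  `⨆ i, (P i).map (ι i)`, is injective (`sumMap_injective`) and has `dim = Σ_i dim (P i)`;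
* `h10V_eq_iSup` — `H^{1,0}(B) = ⨆_i pr_i^* H^{1,0}(A_i)` (the lead's field `h10_pull` is a THEOREM of the
  other fields + the two Voisin displays: `≥` by the compatibility of `pr_i^*` with type `(1,0)`, `≤` by the
  dimension count `12 = 4 · 3`), and `h01V_eq_iSup`;
* `eigSub_eq_range` — the `σ`-eigenspace of `B` is the sum of the pulled-back `σ`-eigenlines of the factors
  (a `K`-eigenvector decomposes along the `act`-stable splitting into `K`-eigenvectors);
* **`finrank_eigSub : dim H¹_σ(B) = 4`** and **`finrank_eigSub_inf_h10V : dim (H¹_σ(B) ∩ H^{1,0}(B)) =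
  #{i | σ ∈ T i}`** — the two numerology fields of the numerology-era `CornerProduct` (T6Host read copy
  ll. 96–118), now theorems.
No host carrier, no display. §8(d): uses an L-value-free non-vanishing device: NO.
-/

namespace Summit.Ventures.HodgeRepro2.T6.A1DictFactors2

open A1Dict A1DictRat A1DictHodge A1EigenSplit A1EigenBasis A1DictFactors

/-! ## 1. The summation map of a family of subspaces of the factors (generic) -/

section sumMap

variable {V : Type*} [AddCommGroup V] [Module ℂ V]
variable {Vf : Fin 4 → Type*} [∀ i, AddCommGroup (Vf i)] [∀ i, Module ℂ (Vf i)]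

/-- The summation map `(x i)_i ↦ ∑ i, ι i (x i)` on `Π_i P i`. -/
noncomputable def sumMap (ι : ∀ i, Vf i →ₗ[ℂ] V) (P : ∀ i, Submodule ℂ (Vf i)) :
    (∀ i, P i) →ₗ[ℂ] V :=
  LinearMap.lsum ℂ (fun i => P i) ℂ fun i => ι i ∘ₗ (P i).subtype

/-- `sumMap ι P x = ∑ i, ι i (x i)`. -/
theorem sumMap_apply (ι : ∀ i, Vf i →ₗ[ℂ] V) (P : ∀ i, Submodule ℂ (Vf i)) (x : ∀ i, P i) :
    sumMap ι P x = ∑ i, ι i (x i) := by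
  simp [sumMap]

/-- The range of `sumMap ι P` is `⨆ i, (P i).map (ι i)`. -/
theorem range_sumMap_eq_iSup (ι : ∀ i, Vf i →ₗ[ℂ] V) (P : ∀ i, Submodule ℂ (Vf i)) :
    LinearMap.range (sumMap ι P) = ⨆ i, (P i).map (ι i) := by
  classical
  apply le_antisymm
  · rintro _ ⟨x, rfl⟩
    rw [sumMap_apply]
    exact Submodule.sum_mem _ fun i _ =>
      Submodule.mem_iSup_of_mem i (Submodule.mem_map_of_mem (x i).2)
  · refine iSup_le fun i => ?_
    rintro _ ⟨u, hu, rfl⟩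
    refine ⟨Pi.single i ⟨u, hu⟩, ?_⟩
    rw [sumMap_apply, Finset.sum_eq_single i]
    · simp
    · intro j _ hji
      rw [Pi.single_eq_of_ne hji, Submodule.coe_zero, map_zero]
    · intro h
      exact absurd (Finset.mem_univ i) h

end sumMap

section factors

variable {K : Type*} [Field K] [NumberField K]
variable {V : Type*} [AddCommGroup V] [Module ℂ V] [Module ℚ V] [IsScalarTower ℚ ℂ V]
variable {Vf : Fin 4 → Type*} [∀ i, AddCommGroup (Vf i)] [∀ i, Module ℂ (Vf i)]
  [∀ i, Module ℚ (Vf i)] [∀ i, IsScalarTower ℚ ℂ (Vf i)]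
variable {F : FaceSetting K} {act : K →+* Module.End ℂ V} {h10V h01V : Submodule ℂ V}
  {ι : ∀ i, Vf i →ₗ[ℂ] V} {actf : ∀ i, K →+* Module.End ℂ (Vf i)} {h10f h01f : ∀ i, Submodule ℂ (Vf i)}
  (D : FactorData F act h10V h01V ι actf h10f h01f)

include D

/-! ## 2. Dimensions through the summation map -/

/-- The independence of the ranges of the `ι i`. -/
theorem iSupIndep_range : iSupIndep fun i => LinearMap.range (ι i) :=
  ((DirectSum.isInternal_submodule_iff_iSupIndep_and_iSup_eq_top _).1 D.isInternal).1

/-- `sumMap P` is injective. -/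
theorem sumMap_injective (P : ∀ i, Submodule ℂ (Vf i)) : Function.Injective (sumMap ι P) := by
  classical
  show Function.Injective (LinearMap.lsum ℂ (fun i => P i) ℂ fun i => ι i ∘ₗ (P i).subtype)
  refine lsum_injective _ ((iSupIndep_range D).mono fun i => ?_)
    fun i => (D.ι_injective i).comp Subtype.val_injective
  rintro _ ⟨u, rfl⟩
  exact ⟨u, rfl⟩

/-- `dim (range (sumMap P)) = ∑ i, dim (P i)`. -/
theorem finrank_range_sumMap (P : ∀ i, Submodule ℂ (Vf i)) :
    Module.finrank ℂ (LinearMap.range (sumMap ι P)) = ∑ i, Module.finrank ℂ (P i) := by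
  haveI : ∀ i, FiniteDimensional ℂ (Vf i) := D.finite_Vf
  rw [LinearMap.finrank_range_of_inj (sumMap_injective D P), Module.finrank_pi_fintype]

/-- `⨆ i, (P i).map (ι i)` has dimension `∑ i, dim (P i)`. -/
theorem finrank_iSup_map (P : ∀ i, Submodule ℂ (Vf i)) :
    Module.finrank ℂ ↥(⨆ i, (P i).map (ι i)) = ∑ i, Module.finrank ℂ (P i) := by
  rw [← range_sumMap_eq_iSup ι P, finrank_range_sumMap D]

/-! ## 3. `H^{1,0}(B) = ⨆_i pr_i^* H^{1,0}(A_i)` — the lead's `h10_pull` as a theorem -/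

/-- `H^{1,0}(B) = ⨆_i pr_i^* H^{1,0}(A_i)`. -/
theorem h10V_eq_iSup : h10V = ⨆ i, (h10f i).map (ι i) := by
  haveI := D.finite_V
  symm
  refine Submodule.eq_of_le_of_finrank_eq (iSup_le D.ι_h10) ?_
  rw [finrank_iSup_map D, D.finrank_hodge_V.1]
  simp only [fun i => (D.finrank_hodge_f i).1, Finset.sum_const, Finset.card_univ, Fintype.card_fin,
    smul_eq_mul]

/-- `H^{0,1}(B) = ⨆_i pr_i^* H^{0,1}(A_i)`. -/
theorem h01V_eq_iSup : h01V = ⨆ i, (h01f i).map (ι i) := by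
  haveI := D.finite_V
  symm
  refine Submodule.eq_of_le_of_finrank_eq (iSup_le D.ι_h01) ?_
  rw [finrank_iSup_map D, D.finrank_hodge_V.2]
  simp only [fun i => (D.finrank_hodge_f i).2, Finset.sum_const, Finset.card_univ, Fintype.card_fin,
    smul_eq_mul]

/-! ## 4. The eigenspaces of `B` along the factors -/

/-- `ι i` sends a `σ`-eigenvector of the factor to a `σ`-eigenvector of `V`. -/
theorem ι_mem_eigSub {i : Fin 4} {σ : K →+* ℂ} {u : Vf i} (hu : u ∈ eigSub (actf i) σ) :
    ι i u ∈ eigSub act σ := by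
  rw [mem_eigSub] at hu ⊢
  intro x
  rw [D.ι_act, hu x, map_smul]

/-- Every vector of `V` is a sum `∑ i, ι i (u i)`. -/
theorem exists_sum_eq (v : V) : ∃ u : ∀ i, Vf i, v = ∑ i, ι i (u i) := by
  classical
  have hv : v ∈ ⨆ i, LinearMap.range (ι i) := by
    rw [((DirectSum.isInternal_submodule_iff_iSupIndep_and_iSup_eq_top _).1 D.isInternal).2]
    exact Submodule.mem_top
  obtain ⟨f, hf, rfl⟩ := (Submodule.mem_iSup_iff_exists_finsupp _ _).1 hv
  choose u hu using fun i => hf i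
  refine ⟨u, ?_⟩
  rw [Finsupp.sum_fintype _ _ fun _ => rfl]
  exact Finset.sum_congr rfl fun i _ => (hu i).symm

/-- THE EIGENSPACES OF `B` ALONG THE FACTORS: `H¹_σ(B) = ⨆_i pr_i^* H¹_σ(A_i)`. -/
theorem eigSub_eq_iSup (σ : K →+* ℂ) : eigSub act σ = ⨆ i, (eigSub (actf i) σ).map (ι i) := by
  classical
  apply le_antisymm
  · intro v hv
    obtain ⟨u, rfl⟩ := exists_sum_eq D v
    have hu : ∀ i, u i ∈ eigSub (actf i) σ := by
      intro i
      rw [mem_eigSub]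
      intro x
      have h1 := (mem_eigSub.1 hv) x
      rw [map_sum, Finset.smul_sum] at h1
      have h2 : ∑ j, ι j (actf j x (u j) - σ x • u j) = 0 := by
        rw [← sub_eq_zero] at h1
        rw [← h1, ← Finset.sum_sub_distrib]
        exact Finset.sum_congr rfl fun j _ => by rw [map_sub, map_smul, D.ι_act]
      have := eq_zero_of_sum_eq_zero (iSupIndep_range D) (fun j => ι j (actf j x (u j) - σ x • u j))
        (fun j => LinearMap.mem_range_self _ _) h2 i
      exact sub_eq_zero.1 (D.ι_injective i (by rw [this, map_zero]))
    exact Submodule.sum_mem _ fun i _ =>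
      Submodule.mem_iSup_of_mem i (Submodule.mem_map_of_mem (hu i))
  · refine iSup_le fun i => ?_
    rintro _ ⟨u, hu, rfl⟩
    exact ι_mem_eigSub D hu

/-- **`dim H¹_σ(B) = 4`** (the numerology field `finrank_eig`, now a theorem). -/
theorem finrank_eigSub (σ : K →+* ℂ) : Module.finrank ℂ (eigSub act σ) = 4 := by
  rw [eigSub_eq_iSup D σ, finrank_iSup_map D]
  simp only [D.line, Finset.sum_const, Finset.card_univ, Fintype.card_fin, smul_eq_mul, mul_one]

/-- A subspace containing non-zero vectors `w i ∈ range (ι i)` for the indices `i` of a finset `s` has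
dimension at least `#s` (the ranges are independent). -/
theorem card_le_finrank_of_mem [FiniteDimensional ℂ V] {U : Submodule ℂ V} (s : Finset (Fin 4))
    (w : Fin 4 → V) (hw : ∀ i, w i ∈ LinearMap.range (ι i)) (hw0 : ∀ i ∈ s, w i ≠ 0)
    (hU : ∀ i ∈ s, w i ∈ U) : s.card ≤ Module.finrank ℂ U := by
  classical
  have hli : LinearIndependent ℂ fun i : s => w i :=
    ((iSupIndep_range D).comp Subtype.val_injective).linearIndependent _ (fun i => hw i)
      fun i => hw0 i i.2
  have hle : Submodule.span ℂ (Set.range fun i : s => w i) ≤ U := by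
    rw [Submodule.span_le]
    rintro _ ⟨i, rfl⟩
    exact hU i i.2
  have h := Submodule.finrank_mono hle
  rwa [finrank_span_eq_card hli, Fintype.card_coe] at h

/-- The pulled-back `σ`-eigenlines of the factors of type `T i ∋ σ` lie in `H¹_σ(B) ∩ H^{1,0}(B)`, those
with `σ ∉ T i` in `H¹_σ(B) ∩ H^{0,1}(B)`: the dimension bounds. -/
theorem card_le_finrank_eigSub_inf (σ : K →+* ℂ) :
    Nat.card {i : Fin 4 // σ ∈ F.T i} ≤ Module.finrank ℂ ↥(eigSub act σ ⊓ h10V) ∧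
      Nat.card {i : Fin 4 // σ ∉ F.T i} ≤ Module.finrank ℂ ↥(eigSub act σ ⊓ h01V) := by
  classical
  haveI := D.finite_V
  -- one non-zero eigenvector in each factor
  have hex : ∀ i, ∃ u ∈ eigSub (actf i) σ, u ≠ 0 := fun i =>
    (Submodule.ne_bot_iff _).1 (eigSub_ne_bot (actf i) (D.line i σ))
  choose u hu hu0 using hex
  have hw : ∀ i, ι i (u i) ∈ LinearMap.range (ι i) := fun i => LinearMap.mem_range_self _ _
  have hw0 : ∀ i, ι i (u i) ≠ 0 := fun i h => hu0 i (D.ι_injective i (by rw [h, map_zero]))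
  constructor
  · have := card_le_finrank_of_mem D (U := eigSub act σ ⊓ h10V) (Finset.univ.filter fun i => σ ∈ F.T i)
      (fun i => ι i (u i)) hw (fun i _ => hw0 i) fun i hi =>
        Submodule.mem_inf.2 ⟨ι_mem_eigSub D (hu i),
          D.eig_h10 i σ (Finset.mem_filter.1 hi).2 _ (hw i) (ι_mem_eigSub D (hu i))⟩
    rwa [← Fintype.card_subtype, ← Nat.card_eq_fintype_card] at this
  · have := card_le_finrank_of_mem D (U := eigSub act σ ⊓ h01V) (Finset.univ.filter fun i => σ ∉ F.T i)
      (fun i => ι i (u i)) hw (fun i _ => hw0 i) fun i hi =>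
        Submodule.mem_inf.2 ⟨ι_mem_eigSub D (hu i),
          D.eig_h01 i σ (Finset.mem_filter.1 hi).2 _ (hw i) (ι_mem_eigSub D (hu i))⟩
    rwa [← Fintype.card_subtype, ← Nat.card_eq_fintype_card] at this

/-- **`dim (H¹_σ(B) ∩ H^{1,0}(B)) = #{i | σ ∈ T i}`** (the numerology field `finrank_eig_h10`, now a
theorem): the two bounds of `card_le_finrank_eigSub_inf` sum to `4 = dim H¹_σ(B)`, and the two pieces
are independent (`H^{1,0} ⊓ H^{0,1} = ⊥`). -/
theorem finrank_eigSub_inf_h10V (σ : K →+* ℂ) :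
    Module.finrank ℂ ↥(eigSub act σ ⊓ h10V) = Nat.card {i : Fin 4 // σ ∈ F.T i} := by
  classical
  haveI := D.finite_V
  obtain ⟨h1, h2⟩ := card_le_finrank_eigSub_inf D σ
  have hcard : Nat.card {i : Fin 4 // σ ∈ F.T i} + Nat.card {i : Fin 4 // σ ∉ F.T i} = 4 := by
    rw [Nat.card_eq_fintype_card, Nat.card_eq_fintype_card, Fintype.card_subtype_compl,
      Nat.add_sub_cancel' (Fintype.card_subtype_le _), Fintype.card_fin]
  -- the two pieces are independent inside `eigSub act σ`
  have hsum := Submodule.finrank_sup_add_finrank_inf_eq (eigSub act σ ⊓ h10V) (eigSub act σ ⊓ h01V)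
  have hinf : (eigSub act σ ⊓ h10V) ⊓ (eigSub act σ ⊓ h01V) = ⊥ := by
    rw [eq_bot_iff]
    intro v hv
    have : v ∈ h10V ⊓ h01V := ⟨hv.1.2, hv.2.2⟩
    rw [D.compl_V.inf_eq_bot] at this
    exact this
  have hsup : (eigSub act σ ⊓ h10V) ⊔ (eigSub act σ ⊓ h01V) ≤ eigSub act σ :=
    sup_le inf_le_left inf_le_left
  have h4 := Submodule.finrank_mono hsup
  rw [finrank_eigSub D σ] at h4
  rw [hinf, finrank_bot, add_zero] at hsum
  omega

end factors

end Summit.Ventures.HodgeRepro2.T6.A1DictFactors2
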